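import Mathlib
import Summits.NavierStokesRegularity.NavierStokesRegularity.Theorems.EulerZoomLiouvillePowerGaugeEulerLiouvilleCasimirFloorEndgame
import Literature.Analysis.FluidPDE.SereginSverakBlowupSelection
import HarnessLib

/-!
# Crux `EulerZoomLiouville.PowerGaugeEulerLiouville` (stmt-NavierStokesRegularity-19832), line `mirror-moment`, stub M4:
# THE MIRROR ENDGAME — Casimir floor + monotone axial moment + persistent ledger blobs + the `E`-gauge force an irrotational past

Route №10 `EulerZoomLiouville` (NavierStokesRegularity), crux E.  Line `mirror-moment` (ideator ns-idea-11 g3;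
`Cruxes/PowerGaugeEulerLiouville/Lines/mirror_moment.lean`), registered stub `stub_mirrorEndgame` (M4), proved here with its signature
UNFOLDED in the tree's vocabulary (the line's `CasimirFloor`, `InClass`, `IsMirrorOutgoingWith`, `MomentMonotone`, `BlobsPersist`,
`VanishesAE`, `axisLedger v x = ‖curl v x‖ / cylRadius x`, `reflZ x = x − (2 x₂) • e₃`, `axialMoment v = ∫ |x₂| · axisLedger v x dx` are
`def`s of the Cruxes file; the statement below is their `δ`-unfolding, so the skeleton fills the stub by `exact mirrorEndgame`).

THE ARGUMENT (the card's M4, engine = the landed K3 kit of LINE A `casimir-floor`, ns-cas-k2: `exists_offAxis_of_curl_ne_zero`,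
`exists_blob_of_curl_ne_zero`, `lintegral_window_sq_curl_le`, `two_add_posLog_le`, `rpow_le_mul_log_of_floor_budget`,
`eventually_mul_log_lt_rpow`, and the lead's `PastIrrotational.ae_eq_zero_of_gauge_of_pastIrrotational`).  GIVEN the Casimir floor (M3 = K2,
landed as `CasimirFloor.casimirFloor`), a member of the class (`0 < ρ ≤ 1/2`) which is mirror-outgoing with radial data `(R₀, β)`,
`β < 1/(2−ρ)`, whose axial ledger moment `M(τ) = ∫ |x₂| η(τ,x) dx` is non-decreasing (M1) and whose ledger blobs persist (M2, landed as
`MirrorMoment.blobsPersist_of_mirrorOutgoingWith`), is trivial: it suffices that every past slice be irrotational.  If `curl u(t₀) ≢ 0`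
(`t₀ < 0`) there is an off-axis ledger blob `B(x₀,δ)`, density `≤ W`, mass `≥ m > 0`.  For `τ < t₀` the avatar `T(τ)` of M2 carries mass
`≥ m` with `0 < η ≤ W` on it, so it lies in the vortex region `{r ≤ R₀(1+|τ|)^β}` (RADIAL control); and AXIAL control is Markov on the monotone
moment: `∫_T |y₂| η(τ) ≤ M(τ) ≤ M(t₀) =: 𝓜`, so `T' = T ∩ {|y₂| ≤ Z₀}`, `Z₀ = 2(𝓜+1)/m`, keeps mass `≥ m/2`
(`lintegral_inter_ge_of_moment_le`).  Hence `T' ⊆ B(0, R₀(1+|τ|)^β + Z₀ + 1)` (`‖y‖ ≤ r(y) + |y₂|`).  THE WINDOW: with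
`s := min 2 (3 − ρ − (2−ρ)β)` one has `2 − ρ < s ≤ 2` and `sβ < 1` (`exponents_of_lt_threshold`; no `1/β` case split), so for
`τ ∈ (−(a^s − 1), t₀)`: `R₀(1+|τ|)^β ≤ R₀ a^{sβ} ≤ a/2` once `a^{1−sβ} ≥ 2R₀` (`radial_le_half`), and `T' ⊆ B(0,a)` once also `Z₀ + 1 ≤ a/2`.
The floor then gives `∫_{B(a)} |curl u(τ)|² ≥ (m/2)²/(8πa(2 + log⁺(2a³W/m)))` per slice; integrating over the window (length `≥ a^s/2`,
`≥ 2|t₀|`) against the budget `∫_{−a²}^{0}∫_{B(a)} |curl u|² ≤ 16 c a^{1−ρ}` yields `a^{s−(2−ρ)} ≤ K₁ log a` for all large `a` — absurd.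
Hence `curl u ≡ 0` on `(−∞,0) × ℝ³`, and the irrotational filler (`T₁ = 0`, `C²` divergence-free slices) concludes.

* `exponents_of_lt_threshold` — `0 < ρ ≤ 1/2`, `0 ≤ β < 1/(2−ρ)`, `s = min 2 (3 − ρ − (2−ρ)β)` ⇒ `2−ρ < s`, `1 ≤ s ≤ 2`, `0 ≤ sβ < 1`;
* `radial_le_half` — `R₀ (1 + (−τ))^β ≤ a/2` on the window `−τ ≤ a^s − 1` once `(2R₀+1)^{1/(1−sβ)} ≤ a`;
* `lintegral_inter_ge_of_moment_le` — the axial Markov step (mass `≥ m/2` survives in `{|y₂| ≤ Z₀}`);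
* **`mirrorEndgame`** — the stub signature, unfolded.

WHAT THIS IS NOT: not NS, not the crux — a helper `--supports` stmt-19832 on the line `mirror-moment`: the endgame of the STRATUM THEOREM
«classical mirror-outgoing swirl-free members of the ρ-class with radial spreading exponent β < 1/(2−ρ) are trivial» modulo the line's lever
M1 `stub_momentMonotone` (OPEN) and the landed M2/M3 — a statement about a hypothetical Euler zoom-limit class; the residue M5 stays OPEN;
nothing here bears on NS regularity itself.  [cite: ChoiJeong2025, Lemma 3.3 (the axial moment); CaffarelliKohnNirenberg1982, §2]
-/

noncomputable section

-- flat `Theorems/<Route><Decl>…` files of one crux share the namespace of the crux (tree convention)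
set_option linter.dupNamespace false

open MeasureTheory Set Filter Topology Metric Function
open scoped NNReal ENNReal

namespace Summit.NavierStokesRegularity.NavierStokesRegularity.Theorems.PowerGaugeEulerLiouville.MirrorMoment

open Literature.Analysis Literature.Analysis.FluidPDE
open Summit.NavierStokesRegularity.NavierStokesRegularity.Theorems.PowerGaugeEulerLiouville.CasimirFloor

open scoped Real

/-! ### Real-variable bookkeeping -/

/-- **The exponents of the window.**  For `0 < ρ ≤ 1/2` and `0 ≤ β < 1/(2−ρ)`, the window exponent `s = min 2 (3 − ρ − (2−ρ)β)` satisfies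
`2 − ρ < s`, `1 ≤ s ≤ 2` and `0 ≤ sβ < 1` — the race `min(2, 1/β) > 2 − ρ ⇔ β < 1/(2−ρ)` of the line, spelled without `1/β`. [folklore] -/
theorem exponents_of_lt_threshold {ρ β s : ℝ} (hρ : 0 < ρ) (hρ2 : ρ ≤ 1 / 2) (hβ0 : 0 ≤ β) (hβ : β < 1 / (2 - ρ))
    (hs : s = min 2 (3 - ρ - (2 - ρ) * β)) :
    2 - ρ < s ∧ 1 ≤ s ∧ s ≤ 2 ∧ 0 ≤ s * β ∧ s * β < 1 := by
  have h2ρ : 0 < 2 - ρ := by linarith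
  -- `x = (2-ρ)β < 1` and `β < 1`
  have hx : (2 - ρ) * β < 1 := by
    have h := (lt_div_iff₀ h2ρ).1 hβ
    linarith
  have hβ1 : β < 1 := by
    have h1 : 1 / (2 - ρ) ≤ 1 := by
      rw [div_le_one h2ρ]; linarith
    linarith
  have hs2 : s ≤ 2 := by rw [hs]; exact min_le_left _ _
  have hs3 : s ≤ 3 - ρ - (2 - ρ) * β := by rw [hs]; exact min_le_right _ _
  have hsρ : 2 - ρ < s := by rw [hs]; exact lt_min (by linarith) (by nlinarith)
  have hs1 : 1 ≤ s := by linarith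
  refine ⟨hsρ, hs1, hs2, by positivity, ?_⟩
  -- `sβ ≤ (3-ρ-(2-ρ)β)β = (2-ρ)β + (1-(2-ρ)β)β < (2-ρ)β + (1-(2-ρ)β) = 1`
  have h1 : s * β ≤ (3 - ρ - (2 - ρ) * β) * β := mul_le_mul_of_nonneg_right hs3 hβ0
  have h2 : (3 - ρ - (2 - ρ) * β) * β = (2 - ρ) * β + (1 - (2 - ρ) * β) * β := by ring
  have h3 : (1 - (2 - ρ) * β) * β < 1 - (2 - ρ) * β := by
    have hpos : 0 < 1 - (2 - ρ) * β := by linarith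
    nlinarith
  linarith

/-- **Radial control on the window.**  With `0 ≤ θ = sβ < 1`, `0 ≤ β`, `0 ≤ R₀`, `1 ≤ a`, `(2R₀+1)^{1/(1−θ)} ≤ a` and `0 ≤ −τ ≤ a^s − 1`:
`R₀ (1 + (−τ))^β ≤ R₀ a^{sβ} ≤ a/2` (`θ ≥ 0` is not needed). [folklore] -/
theorem radial_le_half {R₀ β s a τ : ℝ} (hR₀ : 0 ≤ R₀) (hβ0 : 0 ≤ β) (hθ1 : s * β < 1) (ha1 : 1 ≤ a)
    (haR : (2 * R₀ + 1) ^ (1 / (1 - s * β)) ≤ a) (hτ0 : 0 ≤ -τ) (hτ : -τ ≤ a ^ s - 1) :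
    R₀ * (1 + -τ) ^ β ≤ a / 2 := by
  have ha0 : 0 < a := by linarith
  -- `(1 + (-τ))^β ≤ (a^s)^β = a^{sβ}`
  have h1 : (1 + -τ) ^ β ≤ a ^ (s * β) := by
    rw [Real.rpow_mul ha0.le]
    exact Real.rpow_le_rpow (by linarith) (by linarith) hβ0
  -- `2 R₀ ≤ a^{1 - sβ}`
  have h1θ : 0 < 1 - s * β := by linarith
  have h2 : 2 * R₀ + 1 ≤ a ^ (1 - s * β) := by
    have hb : 0 ≤ 2 * R₀ + 1 := by positivity
    calc 2 * R₀ + 1 = ((2 * R₀ + 1) ^ (1 / (1 - s * β))) ^ (1 - s * β) := by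
          rw [← Real.rpow_mul hb, one_div_mul_cancel h1θ.ne', Real.rpow_one]
      _ ≤ a ^ (1 - s * β) := Real.rpow_le_rpow (Real.rpow_nonneg hb _) haR h1θ.le
  have h3 : a ^ (s * β) * a ^ (1 - s * β) = a := by
    rw [← Real.rpow_add ha0]
    norm_num
  have hθpos : 0 < a ^ (s * β) := Real.rpow_pos_of_pos ha0 _
  calc R₀ * (1 + -τ) ^ β ≤ R₀ * a ^ (s * β) := mul_le_mul_of_nonneg_left h1 hR₀
    _ = (2 * R₀) * a ^ (s * β) / 2 := by ring
    _ ≤ (a ^ (1 - s * β)) * a ^ (s * β) / 2 := by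
        gcongr
        linarith
    _ = a / 2 := by rw [mul_comm, h3]

/-! ### Axial control: Markov on the moment -/

/-- **The axial Markov step.**  If `0 ≤ η`, `∫ |y₂| η ≤ 𝓜` (the weighted ledger being integrable), a measurable `T` carries `∫_T η ≥ m > 0`
and `Z₀ = 2(𝓜+1)/m`, then `T ∩ {|y₂| ≤ Z₀}` still carries `∫ η ≥ m/2` (the mass beyond `|y₂| > Z₀` is `≤ 𝓜/Z₀ < m/2`). [folklore] -/
theorem lintegral_inter_ge_of_moment_le {η : EuclideanSpace ℝ (Fin 3) → ℝ} (hη0 : ∀ y, 0 ≤ η y)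
    (hint : Integrable fun y : EuclideanSpace ℝ (Fin 3) => |y 2| * η y) {Mom : ℝ}
    (hMom : ∫ y, |y 2| * η y ≤ Mom) {T : Set (EuclideanSpace ℝ (Fin 3))} (hT : MeasurableSet T) {m : ℝ} (hm : 0 < m)
    (hmass : ENNReal.ofReal m ≤ ∫⁻ y in T, ENNReal.ofReal (η y)) {Z₀ : ℝ} (hZ₀ : Z₀ = 2 * (Mom + 1) / m) :
    ENNReal.ofReal (m / 2) ≤ ∫⁻ y in T ∩ {y | |y 2| ≤ Z₀}, ENNReal.ofReal (η y) := by
  have hMom0 : 0 ≤ Mom := le_trans (integral_nonneg fun y => mul_nonneg (abs_nonneg _) (hη0 y)) hMom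
  have hZ₀0 : 0 < Z₀ := by rw [hZ₀]; positivity
  have hm2 : Measurable fun y : EuclideanSpace ℝ (Fin 3) => y 2 := (EuclideanSpace.proj (2 : Fin 3)).continuous.measurable
  have hSm : MeasurableSet {y : EuclideanSpace ℝ (Fin 3) | |y 2| ≤ Z₀} := measurableSet_le hm2.abs measurable_const
  -- split `T = (T ∩ S) ∪ (T \ S)`
  set S : Set (EuclideanSpace ℝ (Fin 3)) := {y | |y 2| ≤ Z₀} with hS
  have hsplit : ∫⁻ y in T, ENNReal.ofReal (η y) =
      (∫⁻ y in T ∩ S, ENNReal.ofReal (η y)) + ∫⁻ y in T \ S, ENNReal.ofReal (η y) := by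
    rw [← lintegral_inter_add_sdiff _ T hSm]
  -- the far part: `η ≤ |y₂| η / Z₀` on `T \ S`, so its mass is `≤ 𝓜 / Z₀`
  have hfar : ∫⁻ y in T \ S, ENNReal.ofReal (η y) ≤ ENNReal.ofReal (Mom / Z₀) := by
    have h1 : ∫⁻ y in T \ S, ENNReal.ofReal (η y) ≤ ∫⁻ y in T \ S, ENNReal.ofReal (|y 2| * η y / Z₀) := by
      refine setLIntegral_mono' (hT.diff hSm) fun y hy => ENNReal.ofReal_le_ofReal ?_
      have hy2 : Z₀ < |y 2| := not_le.1 hy.2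
      rw [le_div_iff₀ hZ₀0]
      nlinarith [hη0 y]
    have h2 : ∫⁻ y in T \ S, ENNReal.ofReal (|y 2| * η y / Z₀) ≤ ∫⁻ y, ENNReal.ofReal (|y 2| * η y / Z₀) :=
      setLIntegral_le_lintegral _ _
    have h3 : ∫⁻ y, ENNReal.ofReal (|y 2| * η y / Z₀) = ENNReal.ofReal (∫ y, |y 2| * η y / Z₀) := by
      rw [ofReal_integral_eq_lintegral_ofReal (hint.div_const Z₀)
        (Eventually.of_forall fun y => div_nonneg (mul_nonneg (abs_nonneg _) (hη0 y)) hZ₀0.le)]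
    have h4 : ∫ y, |y 2| * η y / Z₀ ≤ Mom / Z₀ := by
      rw [integral_div]
      exact div_le_div_of_nonneg_right hMom hZ₀0.le
    exact h1.trans (h2.trans (h3.le.trans (ENNReal.ofReal_le_ofReal h4)))
  -- `𝓜 / Z₀ ≤ m/2`
  have hMZ : Mom / Z₀ ≤ m / 2 := by
    rw [hZ₀, div_le_iff₀ (by positivity)]
    have : Mom * m ≤ (Mom + 1) * m := by nlinarith
    calc Mom = Mom * m / m := by field_simp
      _ ≤ m / 2 * (2 * (Mom + 1) / m) := by
          rw [show m / 2 * (2 * (Mom + 1) / m) = (Mom + 1) * m / m by field_simp]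
          exact div_le_div_of_nonneg_right this hm.le
  -- assemble: `m ≤ near + m/2`
  have hm2 : ENNReal.ofReal m = ENNReal.ofReal (m / 2) + ENNReal.ofReal (m / 2) := by
    rw [← ENNReal.ofReal_add (by positivity) (by positivity), add_halves]
  have hle : ENNReal.ofReal (m / 2) + ENNReal.ofReal (m / 2) ≤
      (∫⁻ y in T ∩ S, ENNReal.ofReal (η y)) + ENNReal.ofReal (m / 2) := by
    calc ENNReal.ofReal (m / 2) + ENNReal.ofReal (m / 2) = ENNReal.ofReal m := hm2.symm
      _ ≤ ∫⁻ y in T, ENNReal.ofReal (η y) := hmass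
      _ = (∫⁻ y in T ∩ S, ENNReal.ofReal (η y)) + ∫⁻ y in T \ S, ENNReal.ofReal (η y) := hsplit
      _ ≤ (∫⁻ y in T ∩ S, ENNReal.ofReal (η y)) + ENNReal.ofReal (m / 2) := by
          gcongr
          exact hfar.trans (ENNReal.ofReal_le_ofReal hMZ)
  exact (ENNReal.add_le_add_iff_right ENNReal.ofReal_ne_top).1 hle

/-! ### The stub, unfolded -/

variable {u : ℝ → EuclideanSpace ℝ (Fin 3) → EuclideanSpace ℝ (Fin 3)} {p : ℝ → EuclideanSpace ℝ (Fin 3) → ℝ}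

/-- **M4 `stub_mirrorEndgame` of the line `mirror-moment`, signature unfolded** (`CasimirFloor → ∀ ρ ∈ (0, 1/2], ∀ (u,p,H,c) ∈ InClass ρ,
∀ R₀ β, β < 1/(2−ρ) → IsMirrorOutgoingWith u p R₀ β → MomentMonotone u → BlobsPersist u → VanishesAE u`, with the line's abbreviations
`δ`-unfolded): GIVEN the Casimir floor, a classical mirror-outgoing swirl-free member of the power-gauged class with radial spreading
exponent `β < 1/(2−ρ)`, non-decreasing axial ledger moment and persistent ledger blobs is trivial.  Proof in the module docstring
(irrotational past by the floor-versus-budget race with radial control from the vortex region and axial control from the moment, then the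
landed irrotational filler). [cite: ChoiJeong2025, Lemma 3.3; CaffarelliKohnNirenberg1982, §2] -/
theorem mirrorEndgame :
    (∀ (v : EuclideanSpace ℝ (Fin 3) → EuclideanSpace ℝ (Fin 3)) (T : Set (EuclideanSpace ℝ (Fin 3))) (a W m : ℝ),
        ContDiff ℝ 1 v → 0 < a → 0 < W → 0 < m → MeasurableSet T → T ⊆ ball (0 : EuclideanSpace ℝ (Fin 3)) a →
        (∀ x ∈ T, ‖curl v x‖ / cylRadius x ≤ W) →
        ENNReal.ofReal m ≤ ∫⁻ x in T, ENNReal.ofReal (‖curl v x‖ / cylRadius x) →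
          ENNReal.ofReal (m ^ 2 / (8 * π * a * (2 + max 0 (Real.log (a ^ 3 * W / m))))) ≤
            ∫⁻ x in T, ENNReal.ofReal (‖curl v x‖ ^ 2)) →
      ∀ ρ : ℝ, 0 < ρ → ρ ≤ 1 / 2 →
        ∀ (u : ℝ → EuclideanSpace ℝ (Fin 3) → EuclideanSpace ℝ (Fin 3)) (p : ℝ → EuclideanSpace ℝ (Fin 3) → ℝ)
          (H : ℝ → EuclideanSpace ℝ (Fin 3) → EuclideanSpace ℝ (Fin 3) →L[ℝ] EuclideanSpace ℝ (Fin 3)) (c : ℝ≥0),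
          (IsSuitableWeakSolutionOn (slab (EuclideanSpace ℝ (Fin 3)) (Set.Iio 0) isOpen_Iio) 0 0 u p ∧
              HasWeakSpatialGradientOn (slab (EuclideanSpace ℝ (Fin 3)) (Set.Iio 0) isOpen_Iio) u H ∧
              (∀ a : ℝ, 0 < a →
                ENNReal.ofReal (a ^ (2 * ρ)) * cknA a (0 : ℝ × EuclideanSpace ℝ (Fin 3)) u +
                      ENNReal.ofReal (a ^ ρ) * cknE a (0 : ℝ × EuclideanSpace ℝ (Fin 3)) H +
                    ENNReal.ofReal (a ^ (2 * ρ)) * cknD a (0 : ℝ × EuclideanSpace ℝ (Fin 3)) p ≤ (c : ℝ≥0∞))) →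
            ∀ R₀ β : ℝ, β < 1 / (2 - ρ) →
              (IsClassicalEulerSolutionOn (Set.Iio 0) 0 u p ∧
                  (∀ τ : ℝ, τ < 0 → IsAxisymmetric (u τ) ∧ HasNoSwirl (u τ)) ∧
                  (∀ τ : ℝ, τ < 0 → ∀ x : EuclideanSpace ℝ (Fin 3),
                    u τ (x - (2 * x 2) • (eZ : EuclideanSpace ℝ (Fin 3))) =
                      u τ x - (2 * u τ x 2) • (eZ : EuclideanSpace ℝ (Fin 3))) ∧
                  (∀ τ : ℝ, τ < 0 → ∀ x : EuclideanSpace ℝ (Fin 3), 0 ≤ x 2 * swirl (curl (u τ)) x) ∧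
                  0 ≤ R₀ ∧ 0 ≤ β ∧
                  (∀ τ : ℝ, τ < 0 → ∀ x : EuclideanSpace ℝ (Fin 3), R₀ * (1 + -τ) ^ β < cylRadius x → curl (u τ) x = 0) ∧
                  (∀ τ : ℝ, τ < 0 →
                    Integrable (fun x : EuclideanSpace ℝ (Fin 3) => (1 + ‖x‖) * ‖u τ x‖ ^ 2) ∧
                      Integrable (fun x : EuclideanSpace ℝ (Fin 3) => (1 + ‖x‖) * (‖curl (u τ) x‖ / cylRadius x))) ∧
                  (∀ T T' : ℝ, T ≤ T' → T' < 0 →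
                    ∃ B : ℝ, ∀ τ ∈ Set.Icc T T', ∀ x : EuclideanSpace ℝ (Fin 3), ‖u τ x‖ ≤ B)) →
                (∀ τ₁ τ₂ : ℝ, τ₁ ≤ τ₂ → τ₂ < 0 →
                  ∫ x, |x 2| * (‖curl (u τ₁) x‖ / cylRadius x) ≤ ∫ x, |x 2| * (‖curl (u τ₂) x‖ / cylRadius x)) →
                (∀ t₀ : ℝ, t₀ < 0 → ∀ (x₀ : EuclideanSpace ℝ (Fin 3)) (δ W : ℝ), 0 < δ → δ < cylRadius x₀ →
                    (∀ x ∈ ball x₀ δ, ‖curl (u t₀) x‖ / cylRadius x ≤ W) →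
                    ∀ τ : ℝ, τ < t₀ →
                      ∃ T : Set (EuclideanSpace ℝ (Fin 3)), MeasurableSet T ∧
                        (∀ y ∈ T, 0 < ‖curl (u τ) y‖ / cylRadius y ∧ ‖curl (u τ) y‖ / cylRadius y ≤ W) ∧
                        ∫⁻ x in ball x₀ δ, ENNReal.ofReal (‖curl (u t₀) x‖ / cylRadius x) ≤
                          ∫⁻ y in T, ENNReal.ofReal (‖curl (u τ) y‖ / cylRadius y)) →
                  Function.uncurry u =ᵐ[volume.restrict (Set.Iio (0 : ℝ) ×ˢ (Set.univ : Set (EuclideanSpace ℝ (Fin 3))))] 0 := by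
  intro hK2 ρ hρ hρ2 u p H c hcls R₀ β hβ hstr hmono hblob
  obtain ⟨hsw, hH, hgauge⟩ := hcls
  obtain ⟨hcl, _hsym, _hrefl, _hout, hR₀, hβ0, hsupp, hint, _hbdd⟩ := hstr
  have hE : ∀ a : ℝ, 0 < a →
      ENNReal.ofReal (a ^ ρ) * cknE a (0 : ℝ × EuclideanSpace ℝ (Fin 3)) H ≤ (c : ℝ≥0∞) :=
    fun a ha => (le_add_self.trans le_self_add).trans (hgauge a ha)
  have hC2 : ∀ τ : ℝ, τ < 0 → ContDiff ℝ 2 (u τ) := fun τ hτ => (hcl.contDiff_velocity hτ).of_le (by norm_cast)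
  have hC1 : ∀ τ : ℝ, τ < 0 → ContDiff ℝ 1 (u τ) := fun τ hτ => (hcl.contDiff_velocity hτ).of_le (by norm_cast)
  have hdiv : ∀ τ : ℝ, τ < 0 → VectorCalculus.IsDivFree (u τ) := fun τ hτ => hcl.divFree τ hτ
  suffices hcurl : ∀ τ : ℝ, τ < 0 → ∀ x, curl (u τ) x = 0 from
    PastIrrotational.ae_eq_zero_of_gauge_of_pastIrrotational hρ hρ2 hsw hH hgauge (T₁ := 0) le_rfl hC2 hdiv hcurl
  intro t₀ ht₀
  by_contra hne
  push Not at hne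
  obtain ⟨x₁, hx₁⟩ := hne
  have hcont : Continuous (curl (u t₀)) := continuous_curl (hC1 t₀ ht₀)
  obtain ⟨x₀, hx₀, hc₀⟩ := exists_offAxis_of_curl_ne_zero hcont hx₁
  obtain ⟨δ, W, m, hδ, hδr, hW, hm, hηW, hmass⟩ := exists_blob_of_curl_ne_zero hcont hx₀ hc₀
  -- the ledger density is non-negative and measurable on every slice; the axial moment integrand is integrable
  have hη0 : ∀ (τ : ℝ) (y : EuclideanSpace ℝ (Fin 3)), 0 ≤ ‖curl (u τ) y‖ / cylRadius y :=
    fun τ y => div_nonneg (norm_nonneg _) (cylRadius_nonneg y)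
  have hηm : ∀ τ : ℝ, τ < 0 → Measurable fun y : EuclideanSpace ℝ (Fin 3) => ‖curl (u τ) y‖ / cylRadius y :=
    fun τ hτ => (continuous_curl (hC1 τ hτ)).norm.measurable.div continuous_cylRadius.measurable
  have hm2 : Measurable fun y : EuclideanSpace ℝ (Fin 3) => y 2 := (EuclideanSpace.proj (2 : Fin 3)).continuous.measurable
  have hmomInt : ∀ τ : ℝ, τ < 0 → Integrable fun y : EuclideanSpace ℝ (Fin 3) => |y 2| * (‖curl (u τ) y‖ / cylRadius y) := by
    intro τ hτ
    refine (hint τ hτ).2.mono' ((hm2.abs.mul (hηm τ hτ)).aestronglyMeasurable)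
      (Eventually.of_forall fun y => ?_)
    rw [Real.norm_of_nonneg (mul_nonneg (abs_nonneg _) (hη0 τ y))]
    refine mul_le_mul_of_nonneg_right ?_ (hη0 τ y)
    calc |y 2| = ‖y 2‖ := (Real.norm_eq_abs _).symm
      _ ≤ ‖y‖ := PiLp.norm_apply_le y 2
      _ ≤ 1 + ‖y‖ := by linarith [norm_nonneg y]
  -- the moment at time `t₀` and the axial cut-off `Z₀`
  obtain ⟨Mom, hMom⟩ : ∃ Mom : ℝ, Mom = ∫ y, |y 2| * (‖curl (u t₀) y‖ / cylRadius y) := ⟨_, rfl⟩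
  have hMom0 : 0 ≤ Mom := by
    rw [hMom]; exact integral_nonneg fun y => mul_nonneg (abs_nonneg _) (hη0 t₀ y)
  obtain ⟨Z₀, hZ₀⟩ : ∃ Z₀ : ℝ, Z₀ = 2 * (Mom + 1) / m := ⟨_, rfl⟩
  have hZ₀0 : 0 < Z₀ := by rw [hZ₀]; positivity
  -- exponents
  obtain ⟨s, hs⟩ : ∃ s : ℝ, s = min 2 (3 - ρ - (2 - ρ) * β) := ⟨_, rfl⟩
  obtain ⟨hsρ, hs1, hs2, -, hθ1⟩ := exponents_of_lt_threshold hρ hρ2 hβ0 hβ hs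
  have hε0 : 0 < s - (2 - ρ) := by linarith
  obtain ⟨K₁, hK₁⟩ : ∃ K₁ : ℝ,
      K₁ = 16 * π * (16 * (c : ℝ)) * (2 + |Real.log (W / (m / 2))| + 3) / (1 / 2 * (m / 2) ^ 2) := ⟨_, rfl⟩
  -- a large radius `a`
  obtain ⟨a, haA, hlt⟩ :=
    ((eventually_ge_atTop (max (Real.exp 1) (max (2 * (Z₀ + 1)) (max (2 * (1 + 2 * (-t₀)))
      ((2 * R₀ + 1) ^ (1 / (1 - s * β))))))).and (eventually_mul_log_lt_rpow hε0 K₁)).exists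
  have hae : Real.exp 1 ≤ a := le_trans (le_max_left _ _) haA
  have haZ : 2 * (Z₀ + 1) ≤ a := le_trans ((le_max_left _ _).trans (le_max_right _ _)) haA
  have hat : 2 * (1 + 2 * (-t₀)) ≤ a :=
    le_trans ((le_max_left _ _).trans ((le_max_right _ _).trans (le_max_right _ _))) haA
  have haR : (2 * R₀ + 1) ^ (1 / (1 - s * β)) ≤ a :=
    le_trans ((le_max_right _ _).trans ((le_max_right _ _).trans (le_max_right _ _))) haA
  have ha1 : 1 ≤ a := le_trans (by have := Real.add_one_le_exp (1 : ℝ); linarith) hae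
  have ha0 : 0 < a := by linarith
  have hloga : 1 ≤ Real.log a := by
    rw [Real.le_log_iff_exp_le ha0]
    exact hae
  -- the usable window `(−L_a, t₀)`, `L_a = a^s − 1`
  obtain ⟨La, hLa⟩ : ∃ La : ℝ, La = a ^ s - 1 := ⟨_, rfl⟩
  have has_ge : a ≤ a ^ s := by
    calc a = a ^ (1 : ℝ) := (Real.rpow_one a).symm
      _ ≤ a ^ s := Real.rpow_le_rpow_of_exponent_le ha1 hs1
  have has2 : a ^ s ≤ a ^ 2 := by
    rw [show a ^ 2 = a ^ (2 : ℝ) from (Real.rpow_two a).symm]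
    exact Real.rpow_le_rpow_of_exponent_le ha1 hs2
  have hLa_sq : La ≤ a ^ 2 := by rw [hLa]; linarith
  have hLa_t₀ : 2 * (-t₀) ≤ La := by rw [hLa]; linarith
  have hLa_ge : 1 / 2 * a ^ s ≤ La := by rw [hLa]; linarith
  -- the floor on every slice of the usable window
  have hslice : ∀ t₁ ∈ Ioo (-La) t₀,
      ENNReal.ofReal ((m / 2) ^ 2 / (8 * π * a * (2 + max 0 (Real.log (a ^ 3 * W / (m / 2)))))) ≤
        ∫⁻ x in ball (0 : EuclideanSpace ℝ (Fin 3)) a, ENNReal.ofReal (‖curl (u t₁) x‖ ^ 2) := by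
    intro t₁ ht₁
    have ht₁0 : t₁ < 0 := lt_trans ht₁.2 ht₀
    obtain ⟨T, hTm, hTW, hTmass⟩ := hblob t₀ ht₀ x₀ δ W hδ hδr hηW t₁ ht₁.2
    -- axial control: Markov on the monotone moment
    have hmono' : ∫ y, |y 2| * (‖curl (u t₁) y‖ / cylRadius y) ≤ Mom := by
      rw [hMom]; exact hmono t₁ t₀ ht₁.2.le ht₀
    have hSm : MeasurableSet {y : EuclideanSpace ℝ (Fin 3) | |y 2| ≤ Z₀} := measurableSet_le hm2.abs measurable_const
    have hT'mass := lintegral_inter_ge_of_moment_le (hη0 t₁) (hmomInt t₁ ht₁0) hmono' hTm hm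
      (hmass.trans hTmass) hZ₀
    -- radial control: the avatar lives in the vortex region; so `T' ⊆ B(0,a)`
    have hrad : R₀ * (1 + -t₁) ^ β ≤ a / 2 :=
      radial_le_half hR₀ hβ0 hθ1 ha1 haR (by linarith) (by rw [hLa] at ht₁; linarith [ht₁.1])
    have hT'a : T ∩ {y | |y 2| ≤ Z₀} ⊆ ball (0 : EuclideanSpace ℝ (Fin 3)) a := by
      intro y hy
      have hηpos : 0 < ‖curl (u t₁) y‖ / cylRadius y := (hTW y hy.1).1
      have hcy : curl (u t₁) y ≠ 0 := by
        intro h0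
        rw [h0, norm_zero, zero_div] at hηpos
        exact lt_irrefl _ hηpos
      have hry : cylRadius y ≤ R₀ * (1 + -t₁) ^ β := by
        by_contra hlt'
        exact hcy (hsupp t₁ ht₁0 y (not_le.1 hlt'))
      have hy2 : |y 2| ≤ Z₀ := hy.2
      rw [mem_ball, dist_zero_right]
      calc ‖y‖ ≤ cylRadius y + |y 2| := SereginSverak2009.norm_le_cylRadius_add_abs y
        _ ≤ a / 2 + Z₀ := add_le_add (hry.trans hrad) hy2
        _ < a := by linarith
    exact (hK2 (u t₁) (T ∩ {y | |y 2| ≤ Z₀}) a W (m / 2) (hC1 t₁ ht₁0) ha0 hW (by positivity) (hTm.inter hSm) hT'a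
      (fun y hy => (hTW y hy.1).2) hT'mass).trans (lintegral_mono_set hT'a)
  -- integrate over the usable window and compare with the budget
  obtain ⟨Fa, hFa⟩ : ∃ Fa : ℝ, Fa = (m / 2) ^ 2 / (8 * π * a * (2 + max 0 (Real.log (a ^ 3 * W / (m / 2))))) := ⟨_, rfl⟩
  rw [← hFa] at hslice
  have hLg0 : 0 < 2 + max 0 (Real.log (a ^ 3 * W / (m / 2))) := by positivity
  have hFa0 : 0 < Fa := by rw [hFa]; positivity
  have hIoo : Ioo (-La) t₀ ⊆ Ioo (-a ^ 2) 0 := Ioo_subset_Ioo (by linarith) ht₀.le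
  have hwin : ENNReal.ofReal (Fa * (t₀ - -La)) ≤ ENNReal.ofReal (16 * ((c : ℝ) * a ^ (1 - ρ))) := by
    calc ENNReal.ofReal (Fa * (t₀ - -La)) = ENNReal.ofReal Fa * ENNReal.ofReal (t₀ - -La) :=
          ENNReal.ofReal_mul hFa0.le
      _ = ∫⁻ _ in Ioo (-La) t₀, ENNReal.ofReal Fa := by rw [setLIntegral_const, Real.volume_Ioo]
      _ ≤ ∫⁻ t₁ in Ioo (-La) t₀, ∫⁻ x in ball (0 : EuclideanSpace ℝ (Fin 3)) a, ENNReal.ofReal (‖curl (u t₁) x‖ ^ 2) :=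
          setLIntegral_mono' measurableSet_Ioo hslice
      _ ≤ ∫⁻ t₁ in Ioo (-a ^ 2) 0, ∫⁻ x in ball (0 : EuclideanSpace ℝ (Fin 3)) a, ENNReal.ofReal (‖curl (u t₁) x‖ ^ 2) :=
          lintegral_mono_set hIoo
      _ ≤ ENNReal.ofReal (16 * ((c : ℝ) * a ^ (1 - ρ))) := lintegral_window_sq_curl_le hH hcl hE ha0
  have hbudget : Fa * (t₀ + La) ≤ 16 * (c : ℝ) * a ^ (1 - ρ) := by
    have h := (ENNReal.ofReal_le_ofReal_iff (by positivity)).1 hwin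
    have e : t₀ - -La = t₀ + La := by ring
    rw [e] at h
    linarith
  have hFa' : Fa * (8 * π * a * (2 + max 0 (Real.log (a ^ 3 * W / (m / 2))))) = (m / 2) ^ 2 := by
    rw [hFa]
    field_simp
  -- the race
  have hfin := rpow_le_mul_log_of_floor_budget ha0 (by positivity : (0 : ℝ) < m / 2) (by norm_num : (0 : ℝ) < 1 / 2) hLg0
    (by positivity : (0 : ℝ) ≤ 16 * (c : ℝ)) hFa0 hFa' hbudget hLa_t₀ hLa_ge (two_add_posLog_le ha0 hW (by positivity) hloga)
  rw [← hK₁] at hfin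
  exact absurd hfin (not_le.2 hlt)

end Summit.NavierStokesRegularity.NavierStokesRegularity.Theorems.PowerGaugeEulerLiouville.MirrorMoment

end
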